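import Literature.NumberTheory.Automorphic.Liu2021.AppendixC.AlbaneseFunctorial
import HarnessLib

/-!
# Descent of invariant homomorphisms on an Albanese variety along a trace, up to the order of the group
# (INVENTORY row VI-4 `HonestIsogenyDescent`, generic half — the kernel-checked reduction to a TRACE IDENTITY)

[Liu2021] = Yifeng Liu, *Fourier–Jacobi cycles and arithmetic relative trace formula*, Camb. J. Math. **9** (2021);
carriers `AppendixC.Albanese` (Def. 2.3, `AppendixC/Glue.lean`) and the kernel functoriality `Albanese.map`
(`AppendixC/AlbaneseFunctorial.lean`).  PROOF FILE (theorems only; no definition, no named fact, no instance).  Cell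
hodgecm-mathlib, fan B, row VI-4 (consumer: `Sec42Data.HeckeTranslates.IsogenyDescent` of
`AppendixC/RestOneLevelInvariantsHom.lean`).  HC_CM is proved only modulo the 7 printed citations until rung 0 closes.

THE REDUCTION.  Let `p : X ⟶ Y`, `aX`, `aY` Albanese data, and suppose a homomorphism `t : Alb_Y ⟶ Alb_X` satisfies the
TRACE IDENTITY `Alb_p ≫ t = Σ_{g ∈ Δ} e_g` for a finite family `(e_g)` of endomorphisms of `Alb_X` — for a finite group
`Δ` acting on `X` with quotient `p` and `e_g = Alb_{g}` this `t` is the Albanese TRACE `h_*` of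
[Lang1983AbelianVarieties, Ch. VIII §6, proof of Thm. 13] («`h(v) = Σ φ_U(P_i)` … `f_* h_* = m·δ_{A(V)}`»; for the Galois
cover `U → U/Δ`, `h_* f_* = Σ_g g_*`).  Then every `φ : Alb_X ⟶ B` with `e_g ≫ φ = φ` (all `g`) has
`Alb_p ≫ (t ≫ φ) = |Δ| • φ` (`Albanese.map_comp_trace_comp_eq_card_smul`), so `φ` DESCENDS THROUGH `Alb_p` UP TO THE
NON-ZERO INTEGER `|Δ|` (`Albanese.exists_map_comp_eq_zsmul_of_trace`) — the shape of `IsogenyDescent`.  Pure algebra in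
the preadditive category `AbelianVariety k`; the geometric input (existence of the trace for `X → X/Δ`) is NOT here.
-/

set_option autoImplicit false

noncomputable section

open CategoryTheory AlgebraicGeometry
open Literature.AlgebraicGeometry.Motives (SchemeOver AbelianVariety)

namespace Literature.NumberTheory.Automorphic.Liu2021.AppendixC

universe u

namespace Albanese

variable {k : Type u} [Field k] {X Y : SchemeOver k}

/-- **Trace identity ⟹ `|Δ|`-descent.**  If `t : Alb_Y ⟶ Alb_X` satisfies `Alb_p ≫ t = Σ_{g ∈ Δ} e_g` for a finite family
of endomorphisms `e_g` of `Alb_X` (e.g. `e_g = Alb_{g}` for a finite group acting on `X`, `t` the Albanese trace of the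
quotient `p`), then for every homomorphism `φ : Alb_X ⟶ B` with `e_g ≫ φ = φ` for all `g`:
`Alb_p ≫ (t ≫ φ) = |Δ| • φ`.  (Lang: `f_* h_* = m·δ`, read on invariant homomorphisms.)
[cite: Lang1983AbelianVarieties, Ch. VIII §6 Thm. 13 (proof)] -/
theorem map_comp_trace_comp_eq_card_smul (aX : Albanese X) (aY : Albanese Y) {Δ : Type*} [Fintype Δ]
    (e : Δ → (aX.Alb ⟶ aX.Alb)) (p : X ⟶ Y) (t : aY.Alb ⟶ aX.Alb) (ht : aX.map aY p ≫ t = ∑ g, e g)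
    {B : AbelianVariety k} (φ : aX.Alb ⟶ B) (hφ : ∀ g, e g ≫ φ = φ) :
    aX.map aY p ≫ (t ≫ φ) = (Fintype.card Δ : ℤ) • φ := by
  rw [← Category.assoc, ht, Preadditive.sum_comp]
  simp_rw [hφ]
  rw [Finset.sum_const, Finset.card_univ, natCast_zsmul]

/-- **Descent up to isogeny from a trace**: under the hypotheses of `map_comp_trace_comp_eq_card_smul` (with `Δ`
non-empty), every `φ : Alb_X ⟶ B` invariant under the `e_g` has `Alb_p ≫ ψ = m • φ` for some `ψ : Alb_Y ⟶ B` and some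
integer `m ≠ 0` (namely `ψ = t ≫ φ`, `m = |Δ|`). [cite: Lang1983AbelianVarieties, Ch. VIII §6 Thm. 13 (proof)] -/
theorem exists_map_comp_eq_zsmul_of_trace (aX : Albanese X) (aY : Albanese Y) {Δ : Type*} [Fintype Δ] [Nonempty Δ]
    (e : Δ → (aX.Alb ⟶ aX.Alb)) (p : X ⟶ Y) (t : aY.Alb ⟶ aX.Alb) (ht : aX.map aY p ≫ t = ∑ g, e g)
    {B : AbelianVariety k} (φ : aX.Alb ⟶ B) (hφ : ∀ g, e g ≫ φ = φ) :
    ∃ (m : ℤ) (ψ : aY.Alb ⟶ B), m ≠ 0 ∧ aX.map aY p ≫ ψ = m • φ :=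
  ⟨Fintype.card Δ, t ≫ φ, Int.natCast_ne_zero.2 Fintype.card_ne_zero,
    map_comp_trace_comp_eq_card_smul aX aY e p t ht φ hφ⟩

end Albanese

end Literature.NumberTheory.Automorphic.Liu2021.AppendixC

end
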